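import Mathlib
import HarnessLib
import Literature.MathematicalPhysics.StatisticalMechanics.Crystallization

/-!
# Crux `AperiodicFrustratedLawGap` — second-order calculus of one Lennard-Jones term along a line (hand-1, part A)

Route-independent calculus for the SECOND-ORDER reading of the Nash clause (e) of the crux `AperiodicFrustratedLawGap`
(item `stmt-AtomisticToContinuum-27623`); the companion file `FrustratedLawDichotomyNashLocalStability` sums these
one-term facts over the atoms of a hard-core configuration.  Moving the atom `p` along the line `t ↦ p + t•e`, the
squared distance to another atom `q` is the polynomial `φ(t) = ‖a‖² + 2⟨a, e⟩ t + ‖e‖² t²` (`a = p − q`) and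
`V_LJ(|p + t e − q|) = G(φ(t))` with `G(s) = s⁻⁶/12 − s⁻³/6`; hence (chain rule, all `HasDerivAt`)

* first derivative `G′(φ) φ′` with `G′(s) = −s⁻⁷/2 + s⁻⁴/2`, `φ′(t) = 2⟨a, e⟩ + 2‖e‖² t = 2⟨p + t e − q, e⟩`;
* second derivative `G″(φ) φ′² + G′(φ)·2‖e‖²` with `G″(s) = (7/2) s⁻⁸ − 2 s⁻⁵`;
* uniform bounds for `‖e‖ = 1` in terms of `ρ = |p + t e − q| ≥ ρ₀`: `|f′| ≤ (ρ₀⁻⁷ + ρ₀⁻¹) ρ⁻⁶`,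
  `|f″| ≤ (15 ρ₀⁻⁸ + 9 ρ₀⁻²) ρ⁻⁶`;
* the LAPLACIAN identity: summed over the three coordinate unit vectors at `t = 0`,
  `Σ_i f″_{e_i}(0) = 11 r⁻¹⁴ − 5 r⁻⁸`, `r = |p − q|` (`ΔV_LJ(|x|) = V″ + (2/r)V′ = 11 r⁻¹⁴ − 5 r⁻⁸`).

Plus the one-variable SECOND-ORDER NECESSARY CONDITION `deriv2_nonneg_of_isLocalMin`.  All `[folklore]`.
-/

noncomputable section

open Metric Filter Topology Set
open scoped RealInnerProductSpace

namespace Summit.AtomisticToContinuum.Crystallization.Theorems.FrustratedLawDichotomyNashStabilityCalculus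

open Literature.MathematicalPhysics.StatisticalMechanics (lennardJones)

/-! ## One-variable second-order necessary condition -/

/-- **Second-order necessary condition for a local minimum (one variable).**  If `g` has a local minimum at `x₀`, is
differentiable with derivative `g′` on a neighbourhood of `x₀`, and `g′` has derivative `g″` at `x₀`, then `0 ≤ g″`.
(If `g″ < 0`: `g′(x₀) = 0` by Fermat, so `g′ < 0` just right of `x₀` by the sign lemma, and the mean value theorem
gives `g(x) < g(x₀)` there.) [folklore] -/
theorem deriv2_nonneg_of_isLocalMin {g g' : ℝ → ℝ} {g'' x₀ : ℝ} (hmin : IsLocalMin g x₀)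
    (hg : ∀ᶠ x in 𝓝 x₀, HasDerivAt g (g' x) x) (hg' : HasDerivAt g' g'' x₀) : 0 ≤ g'' := by
  by_contra hneg
  push Not at hneg
  have h0 : g' x₀ = 0 := hmin.hasDerivAt_eq_zero hg.self_of_nhds
  have hd : deriv g' x₀ < 0 := by rw [hg'.deriv]; exact hneg
  have hsign : ∀ᶠ x in 𝓝 x₀, SignType.sign (g' x) = SignType.sign (x₀ - x) :=
    eventually_nhdsWithin_sign_eq_of_deriv_neg hd h0
  have hmin' : ∀ᶠ x in 𝓝 x₀, g x₀ ≤ g x := hmin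
  obtain ⟨ε, hε, hball⟩ := Metric.eventually_nhds_iff_ball.1 ((hg.and hsign).and hmin')
  have hlt : x₀ < x₀ + ε / 2 := by linarith
  have hIcc : ∀ x ∈ Icc x₀ (x₀ + ε / 2), x ∈ ball x₀ ε := fun x hx => by
    rw [mem_ball, Real.dist_eq, abs_of_nonneg (by linarith [hx.1])]
    linarith [hx.2]
  have hcont : ContinuousOn g (Icc x₀ (x₀ + ε / 2)) := fun x hx =>
    (hball x (hIcc x hx)).1.1.continuousAt.continuousWithinAt
  have hder : ∀ x ∈ Ioo x₀ (x₀ + ε / 2), HasDerivAt g (g' x) x := fun x hx =>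
    (hball x (hIcc x (Ioo_subset_Icc_self hx))).1.1
  obtain ⟨c, hc, hslope⟩ := exists_hasDerivAt_eq_slope g g' hlt hcont hder
  have hsc := (hball c (hIcc c (Ioo_subset_Icc_self hc))).1.2
  have hc' : g' c < 0 := by
    have : SignType.sign (x₀ - c) = -1 := sign_neg (by linarith [hc.1])
    rw [this] at hsc
    exact sign_eq_neg_one_iff.1 hsc
  have hpos : 0 < x₀ + ε / 2 - x₀ := by linarith
  have hprod : g (x₀ + ε / 2) - g x₀ = g' c * (x₀ + ε / 2 - x₀) := by
    rw [hslope, div_mul_cancel₀ _ hpos.ne']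
  have hlt' : g (x₀ + ε / 2) < g x₀ := by
    have := mul_neg_of_neg_of_pos hc' hpos
    linarith
  have hx₁ : x₀ + ε / 2 ∈ ball x₀ ε := hIcc _ (right_mem_Icc.2 hlt.le)
  exact absurd (hball _ hx₁).2 (not_le.2 hlt')

/-! ## The squared distance along a line and `V_LJ` as a function of the squared distance -/

/-- `‖a + t•e‖² = ‖a‖² + 2⟨a, e⟩ t + ‖e‖² t²`. [folklore] -/
theorem norm_add_smul_sq (a e : EuclideanSpace ℝ (Fin 3)) (t : ℝ) :
    ‖a + t • e‖ ^ 2 = ‖a‖ ^ 2 + 2 * ⟪a, e⟫ * t + ‖e‖ ^ 2 * t ^ 2 := by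
  rw [norm_add_sq_real, real_inner_smul_right, norm_smul, Real.norm_eq_abs, mul_pow, sq_abs]
  ring

/-- `⟨p + t•e − q, e⟩ = ⟨p − q, e⟩ + ‖e‖² t`, i.e. `φ′(t) = 2⟨p + t e − q, e⟩`. [folklore] -/
theorem two_inner_line (p q e : EuclideanSpace ℝ (Fin 3)) (t : ℝ) :
    2 * ⟪p - q, e⟫ + 2 * ‖e‖ ^ 2 * t = 2 * ⟪p + t • e - q, e⟫ := by
  rw [show p + t • e - q = (p - q) + t • e by abel, inner_add_left, real_inner_smul_left,
    real_inner_self_eq_norm_sq]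
  ring

/-- `V_LJ(r) = G(r²)` with `G(s) = s⁻⁶/12 − s⁻³/6`. [folklore] -/
theorem lennardJones_eq_sq (r : ℝ) :
    lennardJones r = (1 / 12 : ℝ) * (r ^ 2)⁻¹ ^ 6 - (1 / 6 : ℝ) * (r ^ 2)⁻¹ ^ 3 := by
  unfold lennardJones
  ring

/-- `G′`: `HasDerivAt` of `s ↦ s⁻⁶/12 − s⁻³/6` at `s ≠ 0`. [folklore] -/
theorem hasDerivAt_G {s : ℝ} (hs : s ≠ 0) :
    HasDerivAt (fun s : ℝ => (1 / 12 : ℝ) * s⁻¹ ^ 6 - (1 / 6 : ℝ) * s⁻¹ ^ 3)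
      (-(1 / 2 : ℝ) * s⁻¹ ^ 7 + (1 / 2 : ℝ) * s⁻¹ ^ 4) s := by
  have h1 : HasDerivAt (fun y : ℝ => y⁻¹) (-(s ^ 2)⁻¹) s := hasDerivAt_inv hs
  refine (((h1.pow 6).const_mul (1 / 12 : ℝ)).sub ((h1.pow 3).const_mul (1 / 6 : ℝ))).congr_deriv ?_
  push_cast
  ring

/-- `G″`: `HasDerivAt` of `s ↦ −s⁻⁷/2 + s⁻⁴/2` at `s ≠ 0`. [folklore] -/
theorem hasDerivAt_G' {s : ℝ} (hs : s ≠ 0) :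
    HasDerivAt (fun s : ℝ => -(1 / 2 : ℝ) * s⁻¹ ^ 7 + (1 / 2 : ℝ) * s⁻¹ ^ 4)
      ((7 / 2 : ℝ) * s⁻¹ ^ 8 - 2 * s⁻¹ ^ 5) s := by
  have h1 : HasDerivAt (fun y : ℝ => y⁻¹) (-(s ^ 2)⁻¹) s := hasDerivAt_inv hs
  refine (((h1.pow 7).const_mul (-(1 / 2) : ℝ)).add ((h1.pow 4).const_mul (1 / 2 : ℝ))).congr_deriv ?_
  push_cast
  ring

/-- `φ′`: `HasDerivAt` of the squared distance along the line. [folklore] -/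
theorem hasDerivAt_phi (a e : EuclideanSpace ℝ (Fin 3)) (t : ℝ) :
    HasDerivAt (fun t : ℝ => ‖a‖ ^ 2 + 2 * ⟪a, e⟫ * t + ‖e‖ ^ 2 * t ^ 2) (2 * ⟪a, e⟫ + 2 * ‖e‖ ^ 2 * t) t := by
  have h1 : HasDerivAt (fun t : ℝ => 2 * ⟪a, e⟫ * t) (2 * ⟪a, e⟫ * 1) t := (hasDerivAt_id t).const_mul _
  have h2 : HasDerivAt (fun t : ℝ => ‖e‖ ^ 2 * t ^ 2) (‖e‖ ^ 2 * (((2 : ℕ) : ℝ) * t ^ (2 - 1))) t :=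
    (hasDerivAt_pow 2 t).const_mul _
  refine (((hasDerivAt_const t (‖a‖ ^ 2)).add h1).add h2).congr_deriv ?_
  push_cast
  ring

/-- `φ″`: `HasDerivAt` of `φ′`. [folklore] -/
theorem hasDerivAt_phi' (a e : EuclideanSpace ℝ (Fin 3)) (t : ℝ) :
    HasDerivAt (fun t : ℝ => 2 * ⟪a, e⟫ + 2 * ‖e‖ ^ 2 * t) (2 * ‖e‖ ^ 2) t := by
  have h1 : HasDerivAt (fun t : ℝ => 2 * ‖e‖ ^ 2 * t) (2 * ‖e‖ ^ 2 * 1) t := (hasDerivAt_id t).const_mul _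
  refine ((hasDerivAt_const t (2 * ⟪a, e⟫)).add h1).congr_deriv ?_
  ring

/-! ## One Lennard-Jones term along a line: first and second derivatives -/

/-- **First derivative of one term along a line.**  For `p + t•e ≠ q`,
`d/dt V_LJ(|p + t e − q|) = G′(ρ²)·(2⟨p − q, e⟩ + 2‖e‖² t)`, `ρ = |p + t e − q|`. [folklore] -/
theorem hasDerivAt_lennardJones_line {p q e : EuclideanSpace ℝ (Fin 3)} {t : ℝ} (h : p + t • e ≠ q) :
    HasDerivAt (fun t : ℝ => lennardJones (dist (p + t • e) q))
      ((-(1 / 2 : ℝ) * (‖p + t • e - q‖ ^ 2)⁻¹ ^ 7 + (1 / 2 : ℝ) * (‖p + t • e - q‖ ^ 2)⁻¹ ^ 4) *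
        (2 * ⟪p - q, e⟫ + 2 * ‖e‖ ^ 2 * t)) t := by
  have hfun : (fun t : ℝ => lennardJones (dist (p + t • e) q)) =
      (fun s : ℝ => (1 / 12 : ℝ) * s⁻¹ ^ 6 - (1 / 6 : ℝ) * s⁻¹ ^ 3) ∘
        (fun t : ℝ => ‖p - q‖ ^ 2 + 2 * ⟪p - q, e⟫ * t + ‖e‖ ^ 2 * t ^ 2) := by
    funext t
    simp only [Function.comp_apply]
    rw [dist_eq_norm, show p + t • e - q = (p - q) + t • e by abel, lennardJones_eq_sq, norm_add_smul_sq]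
  have hsq : ‖p - q‖ ^ 2 + 2 * ⟪p - q, e⟫ * t + ‖e‖ ^ 2 * t ^ 2 = ‖p + t • e - q‖ ^ 2 := by
    rw [← norm_add_smul_sq, show (p - q) + t • e = p + t • e - q by abel]
  have hs : ‖p - q‖ ^ 2 + 2 * ⟪p - q, e⟫ * t + ‖e‖ ^ 2 * t ^ 2 ≠ 0 := by
    rw [hsq]
    exact pow_ne_zero 2 (norm_ne_zero_iff.2 (sub_ne_zero.2 h))
  rw [hfun]
  have := (hasDerivAt_G hs).comp t (hasDerivAt_phi (p - q) e t)
  rw [hsq] at this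
  exact this

/-- **Second derivative of one term along a line.**  For `p + t•e ≠ q`, the first-derivative function
`t ↦ G′(ρ_t²)·(2⟨p − q, e⟩ + 2‖e‖² t)` has derivative `G″(ρ²) φ′² + G′(ρ²)·2‖e‖²` at `t`. [folklore] -/
theorem hasDerivAt_lennardJones_line_deriv {p q e : EuclideanSpace ℝ (Fin 3)} {t : ℝ} (h : p + t • e ≠ q) :
    HasDerivAt (fun t : ℝ => (-(1 / 2 : ℝ) * (‖p + t • e - q‖ ^ 2)⁻¹ ^ 7 + (1 / 2 : ℝ) * (‖p + t • e - q‖ ^ 2)⁻¹ ^ 4) *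
        (2 * ⟪p - q, e⟫ + 2 * ‖e‖ ^ 2 * t))
      (((7 / 2 : ℝ) * (‖p + t • e - q‖ ^ 2)⁻¹ ^ 8 - 2 * (‖p + t • e - q‖ ^ 2)⁻¹ ^ 5) *
          (2 * ⟪p - q, e⟫ + 2 * ‖e‖ ^ 2 * t) * (2 * ⟪p - q, e⟫ + 2 * ‖e‖ ^ 2 * t) +
        (-(1 / 2 : ℝ) * (‖p + t • e - q‖ ^ 2)⁻¹ ^ 7 + (1 / 2 : ℝ) * (‖p + t • e - q‖ ^ 2)⁻¹ ^ 4) *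
          (2 * ‖e‖ ^ 2)) t := by
  have hfun : (fun t : ℝ => -(1 / 2 : ℝ) * (‖p + t • e - q‖ ^ 2)⁻¹ ^ 7 + (1 / 2 : ℝ) * (‖p + t • e - q‖ ^ 2)⁻¹ ^ 4) =
      (fun s : ℝ => -(1 / 2 : ℝ) * s⁻¹ ^ 7 + (1 / 2 : ℝ) * s⁻¹ ^ 4) ∘
        (fun t : ℝ => ‖p - q‖ ^ 2 + 2 * ⟪p - q, e⟫ * t + ‖e‖ ^ 2 * t ^ 2) := by
    funext t
    simp only [Function.comp_apply]
    rw [show p + t • e - q = (p - q) + t • e by abel, norm_add_smul_sq]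
  have hsq : ‖p - q‖ ^ 2 + 2 * ⟪p - q, e⟫ * t + ‖e‖ ^ 2 * t ^ 2 = ‖p + t • e - q‖ ^ 2 := by
    rw [← norm_add_smul_sq, show (p - q) + t • e = p + t • e - q by abel]
  have hs : ‖p - q‖ ^ 2 + 2 * ⟪p - q, e⟫ * t + ‖e‖ ^ 2 * t ^ 2 ≠ 0 := by
    rw [hsq]
    exact pow_ne_zero 2 (norm_ne_zero_iff.2 (sub_ne_zero.2 h))
  have h1 : HasDerivAt
      (fun t : ℝ => -(1 / 2 : ℝ) * (‖p + t • e - q‖ ^ 2)⁻¹ ^ 7 + (1 / 2 : ℝ) * (‖p + t • e - q‖ ^ 2)⁻¹ ^ 4)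
      (((7 / 2 : ℝ) * (‖p + t • e - q‖ ^ 2)⁻¹ ^ 8 - 2 * (‖p + t • e - q‖ ^ 2)⁻¹ ^ 5) *
        (2 * ⟪p - q, e⟫ + 2 * ‖e‖ ^ 2 * t)) t := by
    rw [hfun]
    have := (hasDerivAt_G' hs).comp t (hasDerivAt_phi (p - q) e t)
    rw [hsq] at this
    exact this
  exact h1.mul (hasDerivAt_phi' (p - q) e t)

/-! ## Uniform bounds (unit direction) -/

/-- `(ρ²)⁻ᵏ = ρ⁻²ᵏ` bookkeeping and the bound `ρ⁻¹³ + ρ⁻⁷ ≤ (ρ₀⁻⁷ + ρ₀⁻¹) ρ⁻⁶` for `ρ ≥ ρ₀ > 0`. [folklore] -/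
theorem inv_pow_13_7_le {ρ₀ ρ : ℝ} (hρ₀ : 0 < ρ₀) (hρ : ρ₀ ≤ ρ) :
    ρ⁻¹ ^ 13 + ρ⁻¹ ^ 7 ≤ (ρ₀⁻¹ ^ 7 + ρ₀⁻¹) * ρ⁻¹ ^ 6 := by
  have hρpos : 0 < ρ := hρ₀.trans_le hρ
  have h0 : 0 ≤ ρ⁻¹ := inv_nonneg.2 hρpos.le
  have h1 : ρ⁻¹ ≤ ρ₀⁻¹ := (inv_le_inv₀ hρpos hρ₀).2 hρ
  have h7 : ρ⁻¹ ^ 7 ≤ ρ₀⁻¹ ^ 7 := pow_le_pow_left₀ h0 h1 7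
  have h6 : 0 ≤ ρ⁻¹ ^ 6 := pow_nonneg h0 6
  calc ρ⁻¹ ^ 13 + ρ⁻¹ ^ 7 = ρ⁻¹ ^ 7 * ρ⁻¹ ^ 6 + ρ⁻¹ * ρ⁻¹ ^ 6 := by ring
    _ ≤ ρ₀⁻¹ ^ 7 * ρ⁻¹ ^ 6 + ρ₀⁻¹ * ρ⁻¹ ^ 6 := by gcongr
    _ = (ρ₀⁻¹ ^ 7 + ρ₀⁻¹) * ρ⁻¹ ^ 6 := by ring

/-- `15 ρ⁻¹⁴ + 9 ρ⁻⁸ ≤ (15 ρ₀⁻⁸ + 9 ρ₀⁻²) ρ⁻⁶` for `ρ ≥ ρ₀ > 0`. [folklore] -/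
theorem inv_pow_14_8_le {ρ₀ ρ : ℝ} (hρ₀ : 0 < ρ₀) (hρ : ρ₀ ≤ ρ) :
    15 * ρ⁻¹ ^ 14 + 9 * ρ⁻¹ ^ 8 ≤ (15 * ρ₀⁻¹ ^ 8 + 9 * ρ₀⁻¹ ^ 2) * ρ⁻¹ ^ 6 := by
  have hρpos : 0 < ρ := hρ₀.trans_le hρ
  have h0 : 0 ≤ ρ⁻¹ := inv_nonneg.2 hρpos.le
  have h1 : ρ⁻¹ ≤ ρ₀⁻¹ := (inv_le_inv₀ hρpos hρ₀).2 hρ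
  have h8 : ρ⁻¹ ^ 8 ≤ ρ₀⁻¹ ^ 8 := pow_le_pow_left₀ h0 h1 8
  have h2 : ρ⁻¹ ^ 2 ≤ ρ₀⁻¹ ^ 2 := pow_le_pow_left₀ h0 h1 2
  have h6 : 0 ≤ ρ⁻¹ ^ 6 := pow_nonneg h0 6
  calc 15 * ρ⁻¹ ^ 14 + 9 * ρ⁻¹ ^ 8 = 15 * (ρ⁻¹ ^ 8 * ρ⁻¹ ^ 6) + 9 * (ρ⁻¹ ^ 2 * ρ⁻¹ ^ 6) := by ring
    _ ≤ 15 * (ρ₀⁻¹ ^ 8 * ρ⁻¹ ^ 6) + 9 * (ρ₀⁻¹ ^ 2 * ρ⁻¹ ^ 6) := by gcongr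
    _ = (15 * ρ₀⁻¹ ^ 8 + 9 * ρ₀⁻¹ ^ 2) * ρ⁻¹ ^ 6 := by ring

/-- **Bound on the first derivative of one term** (unit direction): with `x = p + t e − q`, `ρ = ‖x‖ ≥ ρ₀ > 0` and
`‖e‖ = 1`, `|G′(ρ²)·2⟨x, e⟩| ≤ (ρ₀⁻⁷ + ρ₀⁻¹) ρ⁻⁶`. [folklore] -/
theorem abs_deriv_term_le {ρ₀ : ℝ} (hρ₀ : 0 < ρ₀) {x e : EuclideanSpace ℝ (Fin 3)} (he : ‖e‖ = 1)
    (hx : ρ₀ ≤ ‖x‖) :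
    |(-(1 / 2 : ℝ) * (‖x‖ ^ 2)⁻¹ ^ 7 + (1 / 2 : ℝ) * (‖x‖ ^ 2)⁻¹ ^ 4) * (2 * ⟪x, e⟫)| ≤
      (ρ₀⁻¹ ^ 7 + ρ₀⁻¹) * ‖x‖⁻¹ ^ 6 := by
  have hρpos : 0 < ‖x‖ := hρ₀.trans_le hx
  have h0 : 0 ≤ ‖x‖⁻¹ := inv_nonneg.2 hρpos.le
  have hinner : |⟪x, e⟫| ≤ ‖x‖ := by
    have := abs_real_inner_le_norm x e
    rwa [he, mul_one] at this
  have hrew : (-(1 / 2 : ℝ) * (‖x‖ ^ 2)⁻¹ ^ 7 + (1 / 2 : ℝ) * (‖x‖ ^ 2)⁻¹ ^ 4) * (2 * ⟪x, e⟫) =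
      (-‖x‖⁻¹ ^ 14 + ‖x‖⁻¹ ^ 8) * ⟪x, e⟫ := by ring
  rw [hrew, abs_mul]
  have hcoef : |-‖x‖⁻¹ ^ 14 + ‖x‖⁻¹ ^ 8| ≤ ‖x‖⁻¹ ^ 14 + ‖x‖⁻¹ ^ 8 := by
    refine (abs_add_le _ _).trans ?_
    rw [abs_neg, abs_of_nonneg (pow_nonneg h0 14), abs_of_nonneg (pow_nonneg h0 8)]
  have e14 : ‖x‖⁻¹ ^ 14 * ‖x‖ = ‖x‖⁻¹ ^ 13 := by
    have : ‖x‖⁻¹ * ‖x‖ = 1 := inv_mul_cancel₀ hρpos.ne'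
    calc ‖x‖⁻¹ ^ 14 * ‖x‖ = ‖x‖⁻¹ ^ 13 * (‖x‖⁻¹ * ‖x‖) := by ring
      _ = ‖x‖⁻¹ ^ 13 := by rw [this, mul_one]
  have e8 : ‖x‖⁻¹ ^ 8 * ‖x‖ = ‖x‖⁻¹ ^ 7 := by
    have : ‖x‖⁻¹ * ‖x‖ = 1 := inv_mul_cancel₀ hρpos.ne'
    calc ‖x‖⁻¹ ^ 8 * ‖x‖ = ‖x‖⁻¹ ^ 7 * (‖x‖⁻¹ * ‖x‖) := by ring
      _ = ‖x‖⁻¹ ^ 7 := by rw [this, mul_one]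
  calc |-‖x‖⁻¹ ^ 14 + ‖x‖⁻¹ ^ 8| * |⟪x, e⟫| ≤ (‖x‖⁻¹ ^ 14 + ‖x‖⁻¹ ^ 8) * ‖x‖ :=
        mul_le_mul hcoef hinner (abs_nonneg _) (by positivity)
    _ = ‖x‖⁻¹ ^ 13 + ‖x‖⁻¹ ^ 7 := by rw [add_mul, e14, e8]
    _ ≤ (ρ₀⁻¹ ^ 7 + ρ₀⁻¹) * ‖x‖⁻¹ ^ 6 := inv_pow_13_7_le hρ₀ hx

/-- **Bound on the second derivative of one term** (unit direction): with `x = p + t e − q`, `ρ = ‖x‖ ≥ ρ₀ > 0` and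
`‖e‖ = 1`, `|G″(ρ²)(2⟨x, e⟩)² + G′(ρ²)·2| ≤ (15 ρ₀⁻⁸ + 9 ρ₀⁻²) ρ⁻⁶`. [folklore] -/
theorem abs_deriv2_term_le {ρ₀ : ℝ} (hρ₀ : 0 < ρ₀) {x e : EuclideanSpace ℝ (Fin 3)} (he : ‖e‖ = 1)
    (hx : ρ₀ ≤ ‖x‖) :
    |((7 / 2 : ℝ) * (‖x‖ ^ 2)⁻¹ ^ 8 - 2 * (‖x‖ ^ 2)⁻¹ ^ 5) * (2 * ⟪x, e⟫) * (2 * ⟪x, e⟫) +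
        (-(1 / 2 : ℝ) * (‖x‖ ^ 2)⁻¹ ^ 7 + (1 / 2 : ℝ) * (‖x‖ ^ 2)⁻¹ ^ 4) * (2 * ‖e‖ ^ 2)| ≤
      (15 * ρ₀⁻¹ ^ 8 + 9 * ρ₀⁻¹ ^ 2) * ‖x‖⁻¹ ^ 6 := by
  have hρpos : 0 < ‖x‖ := hρ₀.trans_le hx
  have h0 : 0 ≤ ‖x‖⁻¹ := inv_nonneg.2 hρpos.le
  have hinner : |⟪x, e⟫| ≤ ‖x‖ := by
    have := abs_real_inner_le_norm x e
    rwa [he, mul_one] at this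
  have hinner2 : ⟪x, e⟫ ^ 2 ≤ ‖x‖ ^ 2 := by
    have := sq_le_sq' (abs_le.1 hinner).1 (abs_le.1 hinner).2
    simpa using this
  rw [he]
  have hrew : ((7 / 2 : ℝ) * (‖x‖ ^ 2)⁻¹ ^ 8 - 2 * (‖x‖ ^ 2)⁻¹ ^ 5) * (2 * ⟪x, e⟫) * (2 * ⟪x, e⟫) +
        (-(1 / 2 : ℝ) * (‖x‖ ^ 2)⁻¹ ^ 7 + (1 / 2 : ℝ) * (‖x‖ ^ 2)⁻¹ ^ 4) * (2 * (1 : ℝ) ^ 2) =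
      (14 * ‖x‖⁻¹ ^ 16 - 8 * ‖x‖⁻¹ ^ 10) * ⟪x, e⟫ ^ 2 + (-‖x‖⁻¹ ^ 14 + ‖x‖⁻¹ ^ 8) := by ring
  rw [hrew]
  have hsq : ‖x‖⁻¹ ^ 2 * ‖x‖ ^ 2 = 1 := by
    rw [← mul_pow, inv_mul_cancel₀ hρpos.ne', one_pow]
  have hA : |(14 * ‖x‖⁻¹ ^ 16 - 8 * ‖x‖⁻¹ ^ 10) * ⟪x, e⟫ ^ 2| ≤ 14 * ‖x‖⁻¹ ^ 14 + 8 * ‖x‖⁻¹ ^ 8 := by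
    rw [abs_mul, abs_of_nonneg (sq_nonneg ⟪x, e⟫)]
    have h1 : |14 * ‖x‖⁻¹ ^ 16 - 8 * ‖x‖⁻¹ ^ 10| ≤ 14 * ‖x‖⁻¹ ^ 16 + 8 * ‖x‖⁻¹ ^ 10 := by
      refine (abs_sub _ _).trans ?_
      rw [abs_of_nonneg (by positivity), abs_of_nonneg (by positivity)]
    calc |14 * ‖x‖⁻¹ ^ 16 - 8 * ‖x‖⁻¹ ^ 10| * ⟪x, e⟫ ^ 2
        ≤ (14 * ‖x‖⁻¹ ^ 16 + 8 * ‖x‖⁻¹ ^ 10) * ‖x‖ ^ 2 :=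
          mul_le_mul h1 hinner2 (sq_nonneg _) (by positivity)
      _ = (14 * ‖x‖⁻¹ ^ 14 + 8 * ‖x‖⁻¹ ^ 8) * (‖x‖⁻¹ ^ 2 * ‖x‖ ^ 2) := by ring
      _ = 14 * ‖x‖⁻¹ ^ 14 + 8 * ‖x‖⁻¹ ^ 8 := by rw [hsq, mul_one]
  have hB : |-‖x‖⁻¹ ^ 14 + ‖x‖⁻¹ ^ 8| ≤ ‖x‖⁻¹ ^ 14 + ‖x‖⁻¹ ^ 8 := by
    refine (abs_add_le _ _).trans ?_
    rw [abs_neg, abs_of_nonneg (pow_nonneg h0 14), abs_of_nonneg (pow_nonneg h0 8)]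
  calc |(14 * ‖x‖⁻¹ ^ 16 - 8 * ‖x‖⁻¹ ^ 10) * ⟪x, e⟫ ^ 2 + (-‖x‖⁻¹ ^ 14 + ‖x‖⁻¹ ^ 8)|
      ≤ |(14 * ‖x‖⁻¹ ^ 16 - 8 * ‖x‖⁻¹ ^ 10) * ⟪x, e⟫ ^ 2| + |-‖x‖⁻¹ ^ 14 + ‖x‖⁻¹ ^ 8| := abs_add_le _ _
    _ ≤ (14 * ‖x‖⁻¹ ^ 14 + 8 * ‖x‖⁻¹ ^ 8) + (‖x‖⁻¹ ^ 14 + ‖x‖⁻¹ ^ 8) := add_le_add hA hB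
    _ = 15 * ‖x‖⁻¹ ^ 14 + 9 * ‖x‖⁻¹ ^ 8 := by ring
    _ ≤ (15 * ρ₀⁻¹ ^ 8 + 9 * ρ₀⁻¹ ^ 2) * ‖x‖⁻¹ ^ 6 := inv_pow_14_8_le hρ₀ hx

/-! ## The Laplacian identity -/

/-- **The Laplacian of one Lennard-Jones term.**  Summing the second derivatives at `t = 0` along the three coordinate
unit vectors: `Σ_i [G″(r²)(2⟨a, e_i⟩)² + G′(r²)·2‖e_i‖²] = 11 r⁻¹⁴ − 5 r⁻⁸`, `r = ‖a‖ > 0`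
(`ΔV_LJ(|x|) = V_LJ″(r) + (2/r) V_LJ′(r)`, `V_LJ′ = −r⁻¹³ + r⁻⁷`, `V_LJ″ = 13 r⁻¹⁴ − 7 r⁻⁸`). [folklore] -/
theorem laplacian_lennardJones_term {a : EuclideanSpace ℝ (Fin 3)} (ha : a ≠ 0) :
    ∑ i : Fin 3, (((7 / 2 : ℝ) * (‖a‖ ^ 2)⁻¹ ^ 8 - 2 * (‖a‖ ^ 2)⁻¹ ^ 5) *
          (2 * ⟪a, EuclideanSpace.single i (1 : ℝ)⟫) * (2 * ⟪a, EuclideanSpace.single i (1 : ℝ)⟫) +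
        (-(1 / 2 : ℝ) * (‖a‖ ^ 2)⁻¹ ^ 7 + (1 / 2 : ℝ) * (‖a‖ ^ 2)⁻¹ ^ 4) *
          (2 * ‖EuclideanSpace.single i (1 : ℝ)‖ ^ 2)) =
      11 * ‖a‖⁻¹ ^ 14 - 5 * ‖a‖⁻¹ ^ 8 := by
  have hnorm : 0 < ‖a‖ := norm_pos_iff.2 ha
  have hinner : ∀ i : Fin 3, ⟪a, EuclideanSpace.single i (1 : ℝ)⟫ = a i := fun i => by
    rw [EuclideanSpace.inner_single_right]
    simp
  have hone : ∀ i : Fin 3, ‖EuclideanSpace.single i (1 : ℝ)‖ = 1 := fun i => by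
    simp
  simp_rw [hinner, hone]
  rw [Fin.sum_univ_three]
  have hsum : a 0 ^ 2 + a 1 ^ 2 + a 2 ^ 2 = ‖a‖ ^ 2 := by
    rw [EuclideanSpace.real_norm_sq_eq a, Fin.sum_univ_three]
  have hsq : ‖a‖⁻¹ ^ 2 * ‖a‖ ^ 2 = 1 := by
    rw [← mul_pow, inv_mul_cancel₀ hnorm.ne', one_pow]
  have key : ((7 / 2 : ℝ) * (‖a‖ ^ 2)⁻¹ ^ 8 - 2 * (‖a‖ ^ 2)⁻¹ ^ 5) * (2 * a 0) * (2 * a 0) +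
          (-(1 / 2 : ℝ) * (‖a‖ ^ 2)⁻¹ ^ 7 + (1 / 2 : ℝ) * (‖a‖ ^ 2)⁻¹ ^ 4) * (2 * (1 : ℝ) ^ 2) +
        (((7 / 2 : ℝ) * (‖a‖ ^ 2)⁻¹ ^ 8 - 2 * (‖a‖ ^ 2)⁻¹ ^ 5) * (2 * a 1) * (2 * a 1) +
          (-(1 / 2 : ℝ) * (‖a‖ ^ 2)⁻¹ ^ 7 + (1 / 2 : ℝ) * (‖a‖ ^ 2)⁻¹ ^ 4) * (2 * (1 : ℝ) ^ 2)) +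
        (((7 / 2 : ℝ) * (‖a‖ ^ 2)⁻¹ ^ 8 - 2 * (‖a‖ ^ 2)⁻¹ ^ 5) * (2 * a 2) * (2 * a 2) +
          (-(1 / 2 : ℝ) * (‖a‖ ^ 2)⁻¹ ^ 7 + (1 / 2 : ℝ) * (‖a‖ ^ 2)⁻¹ ^ 4) * (2 * (1 : ℝ) ^ 2)) =
      (14 * ‖a‖⁻¹ ^ 16 - 8 * ‖a‖⁻¹ ^ 10) * (a 0 ^ 2 + a 1 ^ 2 + a 2 ^ 2) +
        3 * (-‖a‖⁻¹ ^ 14 + ‖a‖⁻¹ ^ 8) := by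
    ring
  rw [key, hsum]
  calc (14 * ‖a‖⁻¹ ^ 16 - 8 * ‖a‖⁻¹ ^ 10) * ‖a‖ ^ 2 + 3 * (-‖a‖⁻¹ ^ 14 + ‖a‖⁻¹ ^ 8)
      = (14 * ‖a‖⁻¹ ^ 14 - 8 * ‖a‖⁻¹ ^ 8) * (‖a‖⁻¹ ^ 2 * ‖a‖ ^ 2) + 3 * (-‖a‖⁻¹ ^ 14 + ‖a‖⁻¹ ^ 8) := by ring
    _ = 11 * ‖a‖⁻¹ ^ 14 - 5 * ‖a‖⁻¹ ^ 8 := by rw [hsq]; ring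

end Summit.AtomisticToContinuum.Crystallization.Theorems.FrustratedLawDichotomyNashStabilityCalculus

end
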